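import Literature.NumberTheory.Automorphic.UnitaryGroupFormTransport
import Literature.NumberTheory.Automorphic.AdelicUnitaryGroup
import Literature.Geometry.ComplexHyperbolic.UnitBallU21
import HarnessLib

/-!
# A Sylvester frame of signature `(2,1)` forces the Gram matrix to be hermitian

If `Tᴴ · H^τ · T = J_{2,1} = diag(1, 1, -1)` for some `T ∈ GL₃(ℂ)` and a complex embedding `τ` of the CM
field `L` (the «frame» hypothesis `formCongr (starRingEnd ℂ) T (H.map τ) = BallModel.J` of the tree's
`UnitaryGroup.ShimuraSet`, `Deligne1979ComplexPoints`, `UnitaryShimuraCanonicalModel`), then `H^τ` is a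
hermitian matrix (`H^τ = (T⁻¹)ᴴ · J · T⁻¹` and `J` is hermitian), hence `H` is hermitian for the complex
conjugation `c` of `L`: `c(Hᵢⱼ) = Hⱼᵢ` (every complex embedding of a CM field intertwines `c` with complex
conjugation, Mathlib `IsCMField.complexEmbedding_complexConj`).  Companion of the tree's
`det_ne_zero_of_sylvesterFrame` (`UnitaryGroupLevelDet`).  THEOREMS ONLY.

Use (cells pub-hodgecm / pub-hodgecm2, S2 canonical-model record): the named fact
`UnitaryCanonicalModel.exists_recordSystem` takes the frame `hT` but not «`H` hermitian» among its
hypotheses; consumers building a `UnitaryBallUniformisationDatum` (`conj_H_apply`) or calling the §7 lemmas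
of `UnitaryShimuraCanonicalModel` (`hH : ∀ i j, cmConjRingHom L (H i j) = H j i`) obtain it from here.

## References
* [BergeronMillsonMoeglin2016Balls] N. Bergeron, J. Millson, C. Moeglin, *Hodge type theorems for arithmetic
  manifolds associated to orthogonal groups* / ball quotients, Part 2 §1.1 («choosing a suitable isomorphism
  `V_τ ≅ ℂᵐ` we may write `(u,v) = ᵗū H_{p,q} v`»).
-/

set_option autoImplicit false

noncomputable section

open Matrix NumberField
open scoped Matrix ComplexOrder
open Literature.Geometry.ComplexHyperbolic

namespace Literature.NumberTheory.Automorphic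

namespace UnitaryGroup

/-- `J_{2,1} = diag(1, 1, -1)` is hermitian. [folklore] -/
private theorem isHermitian_J : BallModel.J.IsHermitian := by
  rw [BallModel.J]
  refine Matrix.isHermitian_diagonal_of_self_adjoint _ (funext fun i => ?_)
  fin_cases i <;> simp

/-- **A complex matrix with a Sylvester frame of signature `(2,1)` is hermitian**: if `Tᴴ · Hc · T = J_{2,1}`
for an invertible `T`, then `Hc = (T⁻¹)ᴴ · J_{2,1} · T⁻¹` is hermitian (BMM Part 2 §1.1: the form is
`ᵗū H_{p,q} v` in a suitable basis). [cite: BergeronMillsonMoeglin2016Balls, Part 2 §1.1] -/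
theorem isHermitian_of_conjTranspose_mul_mul_eq_J (Hc : Matrix (Fin 3) (Fin 3) ℂ) (T : GL (Fin 3) ℂ)
    (hT : (T : Matrix (Fin 3) (Fin 3) ℂ)ᴴ * Hc * (T : Matrix (Fin 3) (Fin 3) ℂ) = BallModel.J) :
    Hc.IsHermitian := by
  set S : Matrix (Fin 3) (Fin 3) ℂ := ((T⁻¹ : GL (Fin 3) ℂ) : Matrix (Fin 3) (Fin 3) ℂ) with hS
  have hTS : (T : Matrix (Fin 3) (Fin 3) ℂ) * S = 1 := by
    rw [hS, ← Units.val_mul, mul_inv_cancel, Units.val_one]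
  have hST : S * (T : Matrix (Fin 3) (Fin 3) ℂ) = 1 := by
    rw [hS, ← Units.val_mul, inv_mul_cancel, Units.val_one]
  -- `Hc = Sᴴ · J · S`
  have hHc : Hc = Sᴴ * BallModel.J * S := by
    rw [← hT]
    calc Hc = ((T : Matrix (Fin 3) (Fin 3) ℂ) * S)ᴴ * Hc * ((T : Matrix (Fin 3) (Fin 3) ℂ) * S) := by
          rw [hTS, conjTranspose_one, Matrix.one_mul, Matrix.mul_one]
      _ = Sᴴ * ((T : Matrix (Fin 3) (Fin 3) ℂ)ᴴ * Hc * (T : Matrix (Fin 3) (Fin 3) ℂ)) * S := by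
          rw [conjTranspose_mul]
          simp only [Matrix.mul_assoc]
  rw [hHc]
  exact Matrix.isHermitian_conjTranspose_mul_mul S isHermitian_J

/-- The same in the tree's `formCongr` currency (`formCongr (starRingEnd ℂ) T Hc = Tᴴ · Hc · T` by `rfl`).
[cite: BergeronMillsonMoeglin2016Balls, Part 2 §1.1] -/
theorem isHermitian_of_formCongr_eq_J (Hc : Matrix (Fin 3) (Fin 3) ℂ) (T : GL (Fin 3) ℂ)
    (hT : formCongr (starRingEnd ℂ) T Hc = BallModel.J) : Hc.IsHermitian :=
  isHermitian_of_conjTranspose_mul_mul_eq_J Hc T hT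

/-- **A Sylvester frame at a complex embedding forces `H` to be hermitian for the CM conjugation**: for a CM
field `L`, `τ : L →+* ℂ` and `H ∈ M₃(L)` with `Tᴴ · H^τ · T = J_{2,1}`, one has `c(Hᵢⱼ) = Hⱼᵢ` for the
complex conjugation `c` of `L` (`H^τ` is hermitian and `τ ∘ c = conj ∘ τ`,
`IsCMField.complexEmbedding_complexConj`; `τ` is injective) — the hypothesis `conj_H_apply` / `hH` of the
tree's ball data and of `UnitaryShimuraCanonicalModel` §7, read off the frame.
[cite: BergeronMillsonMoeglin2016Balls, Part 2 §1.1] -/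
theorem cmConjRingHom_apply_eq_of_formCongr_eq_J (L : Type) [Field L] [NumberField L] [IsCMField L]
    (H : Matrix (Fin 3) (Fin 3) L) (τ : L →+* ℂ) (T : GL (Fin 3) ℂ)
    (hT : formCongr (starRingEnd ℂ) T (H.map τ) = BallModel.J) (i j : Fin 3) :
    cmConjRingHom L (H i j) = H j i := by
  have hh := (isHermitian_of_formCongr_eq_J (H.map τ) T hT).apply j i
  -- `hh : star (H.map τ i j) = H.map τ j i`
  apply τ.injective
  rw [embedding_cmConjRingHom]
  simpa only [Matrix.map_apply, Complex.star_def] using hh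

end UnitaryGroup

end Literature.NumberTheory.Automorphic

end
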